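import Summits.ValiantsHypothesis.ValiantsHypothesis.Theorems.LacunarySymmetroidMatrixDescartesCensusDoorBFarTop

/-!
# `MatrixDescartes` census — the far-top STRUCTURE THEOREM in the kernel; door B on whole two-parameter families

HONEST FRAMING.  Object-search cell `pub-symmetroid`, route crux `Theses.LacunarySymmetroid.MatrixDescartes`
(ledger item stmt-ValiantsHypothesis-18050).  Kernel form of engine-1 g14's STRUCTURE THEOREM (THEOREM-LN-E1G14.md
§8, reader PASS theory g16) in its far-top version: writing the Newton quantity of THEOREM L-N (a) as
`M = L_a·∏_i a(U_i) − L_b·∏_i b(U_i) − L_c·∏_i c(U_i)` over the nine upper knots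
`U = (d₃, d₁+d₃, d₂+d₃, 2d₃, d₄, d₁+d₄, d₂+d₄, d₃+d₄, 2d₄)` with `a(x) = x(x−d₁)(x−d₁−d₂)²`,
`b(x) = x(x−d₂)(x−2d₁)(x−d₁−d₂)`, `c(x) = (x−d₁)(x−d₂)²(x−2d₁)`, the ratios `b/a` and `c/a` are DECREASING in
`x > d₁ + d₂` (`b/a = 1 + d₁(d₂−d₁)/((x−d₁)(x−d₁−d₂))`, `c/b = 1 + d₁d₂/(x(x−d₁−d₂))`), and every `U_i` is
non-decreasing in `(d₃, d₄)`; hence Newton-goodness is an UP-SET and a whole far-top two-parameter family is decided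
by ONE numeric corner.
* `farTop_ratioBA_mono`, `farTop_ratioCA_mono` — the per-knot inequalities `b(u)a(v) ≤ b(v)a(u)`,
  `c(u)a(v) ≤ c(v)a(u)` for `d₁ + d₂ < v ≤ u` (exact factorisations, `ring`).
* `farTop_core_mono` — the product-level monotonicity; **`farTop_newton_mono`** — the STRUCTURE THEOREM: the Newton
  hypothesis of `Census.doorB_word_farTop` at a far-top corner `(e₃, e₄)` implies it at every far-top `(d₃, d₄) ≥ (e₃, e₄)`.
* **`doorB_word_on_2_5_0_2_3_farTop`**, `…_0_3_4_farTop`, `…_0_3_5_farTop`, `…_0_4_6_farTop`, `…_0_4_7_farTop` — for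
  ALL `d₃ ≥ 2d₂ + 1` and ALL `d₄ > 2d₃`: every real symmetric `2 × 2` pencil on `(0,d₁,d₂,d₃,d₄)` with `≥ 14` distinct
  positive determinant roots has word `D I I I D` (corner conditions by `decide`); the nine census / ADDENDUM-20
  columns `(0,2,3,7|8|9|10|11,N)`, `(0,3,4,9|10,N)`, `(0,3,5,11|12,N)` as one-line instances — covering all 52
  Newton-good census `(2,5)` fourteen supports and infinitely many more: DOOR B EMPTY there, for pencils, by proof.
Nothing here bears on `ζ_sym`, `DoorA26` / `DoorA34` (OPEN), the crux `MatrixDescartes` or `VP ≠ VNP`.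
[folklore] — elementary; engine-1 g14 (statement, two codes) → engine-1 g15 (kernel).
-/

-- `Summit.ValiantsHypothesis.ValiantsHypothesis.…` repeats a component by the D-0017 layout
-- (single-conjunct summit), which the `dupNamespace` linter flags; the name is mandated.
set_option linter.dupNamespace false

namespace Summit.ValiantsHypothesis.ValiantsHypothesis.Theorems.LacunarySymmetroidMatrixDescartes.Census

open Polynomial Finset
open scoped BigOperators Polynomial Matrix

/-- **Per-knot monotonicity of `B/A`** (engine-1 g14 STRUCTURE §8: `B_f/A_f = 1 + d₁(d₂−d₁)/((f−d₁)(f−d₁−d₂))` is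
decreasing in the upper knot `f`), in product form over `ℤ`: for `d₁ + d₂ < v ≤ u`,
`b(u)·a(v) ≤ b(v)·a(u)` with `a(x) = x(x−d₁)(x−d₁−d₂)²`, `b(x) = x(x−d₂)(x−2d₁)(x−d₁−d₂)`. [folklore] -/
theorem farTop_ratioBA_mono (d₁ d₂ u v : ℤ) (h1 : 0 < d₁) (h12 : d₁ < d₂) (hv : d₁ + d₂ < v) (huv : v ≤ u) :
    (u - 0) * (u - d₂) * (u - 2 * d₁) * (u - (d₁ + d₂)) * ((v - 0) * (v - d₁) * (v - (d₁ + d₂)) ^ 2)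
      ≤ (v - 0) * (v - d₂) * (v - 2 * d₁) * (v - (d₁ + d₂)) * ((u - 0) * (u - d₁) * (u - (d₁ + d₂)) ^ 2) := by
  rw [← sub_nonneg]
  have key : (v - 0) * (v - d₂) * (v - 2 * d₁) * (v - (d₁ + d₂)) * ((u - 0) * (u - d₁) * (u - (d₁ + d₂)) ^ 2)
      - (u - 0) * (u - d₂) * (u - 2 * d₁) * (u - (d₁ + d₂)) * ((v - 0) * (v - d₁) * (v - (d₁ + d₂)) ^ 2)
      = u * v * (u - (d₁ + d₂)) * (v - (d₁ + d₂)) * ((u - v) * (u + v - (2 * d₁ + d₂)) * (d₁ * (d₂ - d₁))) := by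
    ring
  rw [key]
  have ha : 0 ≤ u := by linarith
  have hb : 0 ≤ v := by linarith
  have hc : 0 ≤ u - (d₁ + d₂) := by linarith
  have hd : 0 ≤ v - (d₁ + d₂) := by linarith
  have he : 0 ≤ u - v := by linarith
  have hf : 0 ≤ u + v - (2 * d₁ + d₂) := by linarith
  have hg : 0 ≤ d₁ * (d₂ - d₁) := mul_nonneg h1.le (by linarith)
  exact mul_nonneg (mul_nonneg (mul_nonneg (mul_nonneg ha hb) hc) hd) (mul_nonneg (mul_nonneg he hf) hg)

/-- **Per-knot monotonicity of `C/A`** (`C_f/B_f = 1 + d₁d₂/(f(f−d₁−d₂))` and `B_f/A_f` both decreasing), product form: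
for `d₁ + d₂ < v ≤ u`, `c(u)·a(v) ≤ c(v)·a(u)` with `c(x) = (x−d₁)(x−d₂)²(x−2d₁)`. [folklore] -/
theorem farTop_ratioCA_mono (d₁ d₂ u v : ℤ) (h1 : 0 < d₁) (h12 : d₁ < d₂) (hv : d₁ + d₂ < v) (huv : v ≤ u) :
    (u - d₁) * (u - d₂) ^ 2 * (u - 2 * d₁) * ((v - 0) * (v - d₁) * (v - (d₁ + d₂)) ^ 2)
      ≤ (v - d₁) * (v - d₂) ^ 2 * (v - 2 * d₁) * ((u - 0) * (u - d₁) * (u - (d₁ + d₂)) ^ 2) := by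
  -- C/B step: c(u) b(v) ≤ c(v) b(u)
  have hCB : (u - d₁) * (u - d₂) ^ 2 * (u - 2 * d₁) * ((v - 0) * (v - d₂) * (v - 2 * d₁) * (v - (d₁ + d₂)))
      ≤ (v - d₁) * (v - d₂) ^ 2 * (v - 2 * d₁) * ((u - 0) * (u - d₂) * (u - 2 * d₁) * (u - (d₁ + d₂))) := by
    rw [← sub_nonneg]
    have key : (v - d₁) * (v - d₂) ^ 2 * (v - 2 * d₁) * ((u - 0) * (u - d₂) * (u - 2 * d₁) * (u - (d₁ + d₂)))
        - (u - d₁) * (u - d₂) ^ 2 * (u - 2 * d₁) * ((v - 0) * (v - d₂) * (v - 2 * d₁) * (v - (d₁ + d₂)))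
        = (u - d₂) * (v - d₂) * (u - 2 * d₁) * (v - 2 * d₁) * ((u - v) * (u + v - (d₁ + d₂)) * (d₁ * d₂)) := by
      ring
    rw [key]
    have ha : 0 ≤ u - d₂ := by linarith
    have hb : 0 ≤ v - d₂ := by linarith
    have hc : 0 ≤ u - 2 * d₁ := by linarith
    have hd : 0 ≤ v - 2 * d₁ := by linarith
    have he : 0 ≤ u - v := by linarith
    have hf : 0 ≤ u + v - (d₁ + d₂) := by linarith
    have hg : 0 ≤ d₁ * d₂ := mul_nonneg h1.le (by linarith)
    exact mul_nonneg (mul_nonneg (mul_nonneg (mul_nonneg ha hb) hc) hd) (mul_nonneg (mul_nonneg he hf) hg)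
  have hBA := farTop_ratioBA_mono d₁ d₂ u v h1 h12 hv huv
  have hu0 : 0 < u - 0 := by linarith
  have hu1 : 0 < u - d₁ := by linarith
  have hu2 : 0 < u - d₂ := by linarith
  have hu3 : 0 < u - 2 * d₁ := by linarith
  have hu4 : 0 < u - (d₁ + d₂) := by linarith
  have hv0 : 0 < v - 0 := by linarith
  have hv1 : 0 < v - d₁ := by linarith
  have hv2 : 0 < v - d₂ := by linarith
  have hv3 : 0 < v - 2 * d₁ := by linarith
  have hv4 : 0 < v - (d₁ + d₂) := by linarith
  have hbu : 0 < (u - 0) * (u - d₂) * (u - 2 * d₁) * (u - (d₁ + d₂)) := by positivity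
  have hbv : 0 < (v - 0) * (v - d₂) * (v - 2 * d₁) * (v - (d₁ + d₂)) := by positivity
  have hav : 0 ≤ (v - 0) * (v - d₁) * (v - (d₁ + d₂)) ^ 2 := by positivity
  have hcv : 0 ≤ (v - d₁) * (v - d₂) ^ 2 * (v - 2 * d₁) := by positivity
  have hmul := mul_le_mul hCB hBA (mul_nonneg hbu.le hav) (mul_nonneg hcv hbu.le)
  have e1 : (u - d₁) * (u - d₂) ^ 2 * (u - 2 * d₁) * ((v - 0) * (v - d₂) * (v - 2 * d₁) * (v - (d₁ + d₂)))
        * ((u - 0) * (u - d₂) * (u - 2 * d₁) * (u - (d₁ + d₂)) * ((v - 0) * (v - d₁) * (v - (d₁ + d₂)) ^ 2))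
      = (u - d₁) * (u - d₂) ^ 2 * (u - 2 * d₁) * ((v - 0) * (v - d₁) * (v - (d₁ + d₂)) ^ 2)
        * (((u - 0) * (u - d₂) * (u - 2 * d₁) * (u - (d₁ + d₂))) * ((v - 0) * (v - d₂) * (v - 2 * d₁) * (v - (d₁ + d₂)))) := by
    ac_rfl
  have e2 : (v - d₁) * (v - d₂) ^ 2 * (v - 2 * d₁) * ((u - 0) * (u - d₂) * (u - 2 * d₁) * (u - (d₁ + d₂)))
        * ((v - 0) * (v - d₂) * (v - 2 * d₁) * (v - (d₁ + d₂)) * ((u - 0) * (u - d₁) * (u - (d₁ + d₂)) ^ 2))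
      = (v - d₁) * (v - d₂) ^ 2 * (v - 2 * d₁) * ((u - 0) * (u - d₁) * (u - (d₁ + d₂)) ^ 2)
        * (((u - 0) * (u - d₂) * (u - 2 * d₁) * (u - (d₁ + d₂))) * ((v - 0) * (v - d₂) * (v - 2 * d₁) * (v - (d₁ + d₂)))) := by
    ac_rfl
  rw [e1, e2] at hmul
  exact le_of_mul_le_mul_right hmul (mul_pos hbu hbv)

set_option maxHeartbeats 400000 in
/-- **STRUCTURE THEOREM, far-top form (core inequality).**  If the Newton condition in structured form
`L_b·Π_b(V) + L_c·Π_c(V) ≤ L_a·Π_a(V)` holds for upper knots `V` (all `> d₁ + d₂`) and `V_i ≤ U_i` termwise, then it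
holds for `U` (`L_b, L_c ≥ 0`).  [folklore] -/
theorem farTop_core_mono (d₁ d₂ : ℕ) (h1 : 0 < d₁) (h12 : d₁ < d₂) (U V : Fin 9 → ℕ) (hVU : ∀ i, V i ≤ U i)
    (hV : ∀ i, d₁ + d₂ < V i) (La Lb Lc : ℤ) (hLb : 0 ≤ Lb) (hLc : 0 ≤ Lc)
    (hM0 : Lb * ((∏ i : Fin 9, ((V i : ℤ) - 0)) * (∏ i : Fin 9, ((V i : ℤ) - (d₂ : ℤ))) * (∏ i : Fin 9, ((V i : ℤ) - (2 * d₁ : ℤ))) * (∏ i : Fin 9, ((V i : ℤ) - ((d₁ : ℤ) + d₂))))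
        + Lc * ((∏ i : Fin 9, ((V i : ℤ) - (d₁ : ℤ))) * (∏ i : Fin 9, ((V i : ℤ) - (d₂ : ℤ))) ^ 2 * (∏ i : Fin 9, ((V i : ℤ) - (2 * d₁ : ℤ))))
      ≤ La * ((∏ i : Fin 9, ((V i : ℤ) - 0)) * (∏ i : Fin 9, ((V i : ℤ) - (d₁ : ℤ))) * (∏ i : Fin 9, ((V i : ℤ) - ((d₁ : ℤ) + d₂))) ^ 2)) :
    Lb * ((∏ i : Fin 9, ((U i : ℤ) - 0)) * (∏ i : Fin 9, ((U i : ℤ) - (d₂ : ℤ))) * (∏ i : Fin 9, ((U i : ℤ) - (2 * d₁ : ℤ))) * (∏ i : Fin 9, ((U i : ℤ) - ((d₁ : ℤ) + d₂))))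
        + Lc * ((∏ i : Fin 9, ((U i : ℤ) - (d₁ : ℤ))) * (∏ i : Fin 9, ((U i : ℤ) - (d₂ : ℤ))) ^ 2 * (∏ i : Fin 9, ((U i : ℤ) - (2 * d₁ : ℤ))))
      ≤ La * ((∏ i : Fin 9, ((U i : ℤ) - 0)) * (∏ i : Fin 9, ((U i : ℤ) - (d₁ : ℤ))) * (∏ i : Fin 9, ((U i : ℤ) - ((d₁ : ℤ) + d₂))) ^ 2) := by
  have z1 : (0 : ℤ) < d₁ := by exact_mod_cast h1
  have z12 : (d₁ : ℤ) < d₂ := by exact_mod_cast h12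
  have zV : ∀ i, (d₁ : ℤ) + d₂ < V i := fun i => by exact_mod_cast hV i
  have zVU : ∀ i, (V i : ℤ) ≤ U i := fun i => by exact_mod_cast hVU i
  have zU : ∀ i, (d₁ : ℤ) + d₂ < U i := fun i => lt_of_lt_of_le (zV i) (zVU i)
  -- merged per-knot products
  have eA : ∀ W : Fin 9 → ℕ, (∏ i : Fin 9, ((W i : ℤ) - 0)) * (∏ i : Fin 9, ((W i : ℤ) - (d₁ : ℤ))) * (∏ i : Fin 9, ((W i : ℤ) - ((d₁ : ℤ) + d₂))) ^ 2
      = ∏ i : Fin 9, (((W i : ℤ) - 0) * ((W i : ℤ) - (d₁ : ℤ)) * ((W i : ℤ) - ((d₁ : ℤ) + d₂)) ^ 2) := by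
    intro W; simp only [Finset.prod_mul_distrib, Finset.prod_pow]
  have eB : ∀ W : Fin 9 → ℕ, (∏ i : Fin 9, ((W i : ℤ) - 0)) * (∏ i : Fin 9, ((W i : ℤ) - (d₂ : ℤ))) * (∏ i : Fin 9, ((W i : ℤ) - (2 * d₁ : ℤ))) * (∏ i : Fin 9, ((W i : ℤ) - ((d₁ : ℤ) + d₂)))
      = ∏ i : Fin 9, (((W i : ℤ) - 0) * ((W i : ℤ) - (d₂ : ℤ)) * ((W i : ℤ) - (2 * d₁ : ℤ)) * ((W i : ℤ) - ((d₁ : ℤ) + d₂))) := by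
    intro W; simp only [Finset.prod_mul_distrib]
  have eC : ∀ W : Fin 9 → ℕ, (∏ i : Fin 9, ((W i : ℤ) - (d₁ : ℤ))) * (∏ i : Fin 9, ((W i : ℤ) - (d₂ : ℤ))) ^ 2 * (∏ i : Fin 9, ((W i : ℤ) - (2 * d₁ : ℤ)))
      = ∏ i : Fin 9, (((W i : ℤ) - (d₁ : ℤ)) * ((W i : ℤ) - (d₂ : ℤ)) ^ 2 * ((W i : ℤ) - (2 * d₁ : ℤ))) := by
    intro W; simp only [Finset.prod_mul_distrib, Finset.prod_pow]
  rw [eA, eB, eC] at hM0 ⊢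
  -- positivity of the factors
  have ha : ∀ W : Fin 9 → ℕ, (∀ i, (d₁ : ℤ) + d₂ < W i) → ∀ i, 0 < (((W i : ℤ) - 0) * ((W i : ℤ) - (d₁ : ℤ)) * ((W i : ℤ) - ((d₁ : ℤ) + d₂)) ^ 2) := by
    intro W hW i
    have : 0 < (W i : ℤ) - 0 := by linarith [hW i]
    have : 0 < (W i : ℤ) - (d₁ : ℤ) := by linarith [hW i]
    have : 0 < (W i : ℤ) - ((d₁ : ℤ) + d₂) := by linarith [hW i]
    positivity
  have hb : ∀ W : Fin 9 → ℕ, (∀ i, (d₁ : ℤ) + d₂ < W i) → ∀ i, 0 ≤ (((W i : ℤ) - 0) * ((W i : ℤ) - (d₂ : ℤ)) * ((W i : ℤ) - (2 * d₁ : ℤ)) * ((W i : ℤ) - ((d₁ : ℤ) + d₂))) := by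
    intro W hW i
    have : 0 ≤ (W i : ℤ) - 0 := by linarith [hW i]
    have : 0 ≤ (W i : ℤ) - (d₂ : ℤ) := by linarith [hW i]
    have : 0 ≤ (W i : ℤ) - (2 * d₁ : ℤ) := by linarith [hW i]
    have : 0 ≤ (W i : ℤ) - ((d₁ : ℤ) + d₂) := by linarith [hW i]
    positivity
  have hc : ∀ W : Fin 9 → ℕ, (∀ i, (d₁ : ℤ) + d₂ < W i) → ∀ i, 0 ≤ (((W i : ℤ) - (d₁ : ℤ)) * ((W i : ℤ) - (d₂ : ℤ)) ^ 2 * ((W i : ℤ) - (2 * d₁ : ℤ))) := by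
    intro W hW i
    have : 0 ≤ (W i : ℤ) - (d₁ : ℤ) := by linarith [hW i]
    have : 0 ≤ (W i : ℤ) - (2 * d₁ : ℤ) := by linarith [hW i]
    positivity
  -- termwise monotonicity
  have hBA : ∀ i, (((U i : ℤ) - 0) * ((U i : ℤ) - (d₂ : ℤ)) * ((U i : ℤ) - (2 * d₁ : ℤ)) * ((U i : ℤ) - ((d₁ : ℤ) + d₂))) * (((V i : ℤ) - 0) * ((V i : ℤ) - (d₁ : ℤ)) * ((V i : ℤ) - ((d₁ : ℤ) + d₂)) ^ 2) ≤ (((V i : ℤ) - 0) * ((V i : ℤ) - (d₂ : ℤ)) * ((V i : ℤ) - (2 * d₁ : ℤ)) * ((V i : ℤ) - ((d₁ : ℤ) + d₂))) * (((U i : ℤ) - 0) * ((U i : ℤ) - (d₁ : ℤ)) * ((U i : ℤ) - ((d₁ : ℤ) + d₂)) ^ 2) :=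
    fun i => by
      have := farTop_ratioBA_mono (d₁ : ℤ) d₂ (U i) (V i) z1 z12 (zV i) (zVU i)
      linarith
  have hCA : ∀ i, (((U i : ℤ) - (d₁ : ℤ)) * ((U i : ℤ) - (d₂ : ℤ)) ^ 2 * ((U i : ℤ) - (2 * d₁ : ℤ))) * (((V i : ℤ) - 0) * ((V i : ℤ) - (d₁ : ℤ)) * ((V i : ℤ) - ((d₁ : ℤ) + d₂)) ^ 2) ≤ (((V i : ℤ) - (d₁ : ℤ)) * ((V i : ℤ) - (d₂ : ℤ)) ^ 2 * ((V i : ℤ) - (2 * d₁ : ℤ))) * (((U i : ℤ) - 0) * ((U i : ℤ) - (d₁ : ℤ)) * ((U i : ℤ) - ((d₁ : ℤ) + d₂)) ^ 2) :=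
    fun i => by
      have := farTop_ratioCA_mono (d₁ : ℤ) d₂ (U i) (V i) z1 z12 (zV i) (zVU i)
      linarith
  have PB : (∏ i : Fin 9, (((U i : ℤ) - 0) * ((U i : ℤ) - (d₂ : ℤ)) * ((U i : ℤ) - (2 * d₁ : ℤ)) * ((U i : ℤ) - ((d₁ : ℤ) + d₂)))) * (∏ i : Fin 9, (((V i : ℤ) - 0) * ((V i : ℤ) - (d₁ : ℤ)) * ((V i : ℤ) - ((d₁ : ℤ) + d₂)) ^ 2))
      ≤ (∏ i : Fin 9, (((V i : ℤ) - 0) * ((V i : ℤ) - (d₂ : ℤ)) * ((V i : ℤ) - (2 * d₁ : ℤ)) * ((V i : ℤ) - ((d₁ : ℤ) + d₂)))) * (∏ i : Fin 9, (((U i : ℤ) - 0) * ((U i : ℤ) - (d₁ : ℤ)) * ((U i : ℤ) - ((d₁ : ℤ) + d₂)) ^ 2)) := by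
    rw [← Finset.prod_mul_distrib, ← Finset.prod_mul_distrib]
    exact Finset.prod_le_prod (fun i _ => mul_nonneg (hb U zU i) (ha V zV i).le) (fun i _ => hBA i)
  have PC : (∏ i : Fin 9, (((U i : ℤ) - (d₁ : ℤ)) * ((U i : ℤ) - (d₂ : ℤ)) ^ 2 * ((U i : ℤ) - (2 * d₁ : ℤ)))) * (∏ i : Fin 9, (((V i : ℤ) - 0) * ((V i : ℤ) - (d₁ : ℤ)) * ((V i : ℤ) - ((d₁ : ℤ) + d₂)) ^ 2))
      ≤ (∏ i : Fin 9, (((V i : ℤ) - (d₁ : ℤ)) * ((V i : ℤ) - (d₂ : ℤ)) ^ 2 * ((V i : ℤ) - (2 * d₁ : ℤ)))) * (∏ i : Fin 9, (((U i : ℤ) - 0) * ((U i : ℤ) - (d₁ : ℤ)) * ((U i : ℤ) - ((d₁ : ℤ) + d₂)) ^ 2)) := by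
    rw [← Finset.prod_mul_distrib, ← Finset.prod_mul_distrib]
    exact Finset.prod_le_prod (fun i _ => mul_nonneg (hc U zU i) (ha V zV i).le) (fun i _ => hCA i)
  have hAV : 0 < ∏ i : Fin 9, (((V i : ℤ) - 0) * ((V i : ℤ) - (d₁ : ℤ)) * ((V i : ℤ) - ((d₁ : ℤ) + d₂)) ^ 2) := Finset.prod_pos fun i _ => ha V zV i
  have hAU : 0 < ∏ i : Fin 9, (((U i : ℤ) - 0) * ((U i : ℤ) - (d₁ : ℤ)) * ((U i : ℤ) - ((d₁ : ℤ) + d₂)) ^ 2) := Finset.prod_pos fun i _ => ha U zU i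
  set PAU := ∏ i : Fin 9, (((U i : ℤ) - 0) * ((U i : ℤ) - (d₁ : ℤ)) * ((U i : ℤ) - ((d₁ : ℤ) + d₂)) ^ 2) with hPAU
  set PAV := ∏ i : Fin 9, (((V i : ℤ) - 0) * ((V i : ℤ) - (d₁ : ℤ)) * ((V i : ℤ) - ((d₁ : ℤ) + d₂)) ^ 2) with hPAV
  set PBU := ∏ i : Fin 9, (((U i : ℤ) - 0) * ((U i : ℤ) - (d₂ : ℤ)) * ((U i : ℤ) - (2 * d₁ : ℤ)) * ((U i : ℤ) - ((d₁ : ℤ) + d₂))) with hPBU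
  set PBV := ∏ i : Fin 9, (((V i : ℤ) - 0) * ((V i : ℤ) - (d₂ : ℤ)) * ((V i : ℤ) - (2 * d₁ : ℤ)) * ((V i : ℤ) - ((d₁ : ℤ) + d₂))) with hPBV
  set PCU := ∏ i : Fin 9, (((U i : ℤ) - (d₁ : ℤ)) * ((U i : ℤ) - (d₂ : ℤ)) ^ 2 * ((U i : ℤ) - (2 * d₁ : ℤ))) with hPCU
  set PCV := ∏ i : Fin 9, (((V i : ℤ) - (d₁ : ℤ)) * ((V i : ℤ) - (d₂ : ℤ)) ^ 2 * ((V i : ℤ) - (2 * d₁ : ℤ))) with hPCV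
  have s1 : Lb * (PBU * PAV) ≤ Lb * (PBV * PAU) := mul_le_mul_of_nonneg_left PB hLb
  have s2 : Lc * (PCU * PAV) ≤ Lc * (PCV * PAU) := mul_le_mul_of_nonneg_left PC hLc
  have s3 : (Lb * PBV + Lc * PCV) * PAU ≤ (La * PAV) * PAU := mul_le_mul_of_nonneg_right hM0 hAU.le
  have goal' : (Lb * PBU + Lc * PCU) * PAV ≤ (La * PAU) * PAV :=
    calc (Lb * PBU + Lc * PCU) * PAV = Lb * (PBU * PAV) + Lc * (PCU * PAV) := by ring
      _ ≤ Lb * (PBV * PAU) + Lc * (PCV * PAU) := add_le_add s1 s2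
      _ = (Lb * PBV + Lc * PCV) * PAU := by ring
      _ ≤ (La * PAV) * PAU := s3
      _ = (La * PAU) * PAV := by ring
  exact le_of_mul_le_mul_right goal' hAV

set_option maxHeartbeats 400000 in
/-- **STRUCTURE THEOREM (far-top form, kernel): Newton-goodness is an UP-SET in `(d₃, d₄)`.**  For fixed class-G
`(d₁, d₂)`: if the Newton condition of `Census.doorB_word_farTop` holds at a far-top corner `(e₃, e₄)`
(`2d₂ < e₃`, `2e₃ < e₄`) then it holds at every far-top `(d₃, d₄)` with `e₃ ≤ d₃`, `e₄ ≤ d₄` (engine-1 g14,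
THEOREM-LN §8: each of the nine upper knots is non-decreasing in `(d₃, d₄)` and the ratios `B_f/A_f`, `C_f/A_f` are
decreasing in the knot `f`).  So door B on a whole far-top two-parameter family reduces to ONE numeric corner check.
[folklore] -/
theorem farTop_newton_mono (d₁ d₂ d₃ d₄ e₃ e₄ : ℕ) (h1 : 0 < d₁) (h12 : d₁ < d₂) (h21 : d₂ < 2 * d₁)
    (he23 : 2 * d₂ < e₃) (he34 : 2 * e₃ < e₄) (h3 : e₃ ≤ d₃) (h4 : e₄ ≤ d₄) (hd34 : 2 * d₃ < d₄)
    (hM0 : (∏ j ∈ univ.erase (0 : Fin 15), |((![0, d₁, d₂, 2 * d₁, d₁ + d₂, 2 * d₂, e₃, d₁ + e₃, d₂ + e₃, 2 * e₃, e₄, d₁ + e₄, d₂ + e₄, e₃ + e₄, 2 * e₄] : Fin 15 → ℕ) 0 : ℤ) - (![0, d₁, d₂, 2 * d₁, d₁ + d₂, 2 * d₂, e₃, d₁ + e₃, d₂ + e₃, 2 * e₃, e₄, d₁ + e₄, d₂ + e₄, e₃ + e₄, 2 * e₄] : Fin 15 → ℕ) j|) * (∏ j ∈ univ.erase (2 :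 Fin 15), |((![0, d₁, d₂, 2 * d₁, d₁ + d₂, 2 * d₂, e₃, d₁ + e₃, d₂ + e₃, 2 * e₃, e₄, d₁ + e₄, d₂ + e₄, e₃ + e₄, 2 * e₄] : Fin 15 → ℕ) 2 : ℤ) - (![0, d₁, d₂, 2 * d₁, d₁ + d₂, 2 * d₂, e₃, d₁ + e₃, d₂ + e₃, 2 * e₃, e₄, d₁ + e₄, d₂ + e₄, e₃ + e₄, 2 * e₄] : Fin 15 → ℕ) j|)
          * (∏ j ∈ univ.erase (3 : Fin 15), |((![0, d₁, d₂, 2 * d₁, d₁ + d₂, 2 * d₂, e₃, d₁ + e₃, d₂ + e₃, 2 * e₃, e₄, d₁ + e₄, d₂ + e₄, e₃ + e₄, 2 * e₄] : Fin 15 → ℕ) 3 : ℤ) - (![0, d₁, d₂, 2 * d₁, d₁ + d₂, 2 * d₂, e₃, d₁ + e₃, d₂ + e₃, 2 * e₃, e₄, d₁ + e₄, d₂ + e₄, e₃ + e₄, 2 * e₄] : Fin 15 → ℕ) j|) * (∏ j ∈ univ.erase (4 : Fin 15), |((![0, d₁, d₂, 2 * d₁, d₁ + d₂, 2 * d₂,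 e₃, d₁ + e₃, d₂ + e₃, 2 * e₃, e₄, d₁ + e₄, d₂ + e₄, e₃ + e₄, 2 * e₄] : Fin 15 → ℕ) 4 : ℤ) - (![0, d₁, d₂, 2 * d₁, d₁ + d₂, 2 * d₂, e₃, d₁ + e₃, d₂ + e₃, 2 * e₃, e₄, d₁ + e₄, d₂ + e₄, e₃ + e₄, 2 * e₄] : Fin 15 → ℕ) j|)
        + (∏ j ∈ univ.erase (1 : Fin 15), |((![0, d₁, d₂, 2 * d₁, d₁ + d₂, 2 * d₂, e₃, d₁ + e₃, d₂ + e₃, 2 * e₃, e₄, d₁ + e₄, d₂ + e₄, e₃ + e₄, 2 * e₄] : Fin 15 → ℕ) 1 : ℤ) - (![0, d₁, d₂, 2 * d₁, d₁ + d₂, 2 * d₂, e₃, d₁ + e₃, d₂ + e₃, 2 * e₃, e₄, d₁ + e₄, d₂ + e₄, e₃ + e₄, 2 * e₄] : Fin 15 → ℕ) j|) * (∏ j ∈ univ.erase (2 : Fin 15), |((![0, d₁, d₂, 2 * d₁, d₁ + d₂, 2 * d₂, e₃, d₁ + e₃, d₂ + e₃, 2 * e₃, e₄, d₁ + e₄,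 d₂ + e₄, e₃ + e₄, 2 * e₄] : Fin 15 → ℕ) 2 : ℤ) - (![0, d₁, d₂, 2 * d₁, d₁ + d₂, 2 * d₂, e₃, d₁ + e₃, d₂ + e₃, 2 * e₃, e₄, d₁ + e₄, d₂ + e₄, e₃ + e₄, 2 * e₄] : Fin 15 → ℕ) j|) ^ 2
          * (∏ j ∈ univ.erase (3 : Fin 15), |((![0, d₁, d₂, 2 * d₁, d₁ + d₂, 2 * d₂, e₃, d₁ + e₃, d₂ + e₃, 2 * e₃, e₄, d₁ + e₄, d₂ + e₄, e₃ + e₄, 2 * e₄] : Fin 15 → ℕ) 3 : ℤ) - (![0, d₁, d₂, 2 * d₁, d₁ + d₂, 2 * d₂, e₃, d₁ + e₃, d₂ + e₃, 2 * e₃, e₄, d₁ + e₄, d₂ + e₄, e₃ + e₄, 2 * e₄] : Fin 15 → ℕ) j|)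
      ≤ (∏ j ∈ univ.erase (0 : Fin 15), |((![0, d₁, d₂, 2 * d₁, d₁ + d₂, 2 * d₂, e₃, d₁ + e₃, d₂ + e₃, 2 * e₃, e₄, d₁ + e₄, d₂ + e₄, e₃ + e₄, 2 * e₄] : Fin 15 → ℕ) 0 : ℤ) - (![0, d₁, d₂, 2 * d₁, d₁ + d₂, 2 * d₂, e₃, d₁ + e₃, d₂ + e₃, 2 * e₃, e₄, d₁ + e₄, d₂ + e₄, e₃ + e₄, 2 * e₄] : Fin 15 → ℕ) j|) * (∏ j ∈ univ.erase (1 : Fin 15), |((![0, d₁, d₂, 2 * d₁, d₁ + d₂, 2 * d₂, e₃, d₁ + e₃, d₂ + e₃, 2 * e₃, e₄, d₁ + e₄, d₂ + e₄, e₃ + e₄, 2 * e₄] : Fin 15 → ℕ) 1 : ℤ) - (![0, d₁, d₂, 2 * d₁, d₁ + d₂, 2 * d₂, e₃, d₁ + e₃, d₂ + e₃, 2 * e₃, e₄, d₁ + e₄, d₂ + e₄, e₃ + e₄, 2 * e₄] : Fin 15 → ℕ) j|)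
          * (∏ j ∈ univ.erase (4 : Fin 15), |((![0, d₁, d₂, 2 * d₁, d₁ + d₂, 2 * d₂, e₃, d₁ + e₃, d₂ + e₃, 2 * e₃, e₄, d₁ + e₄, d₂ + e₄, e₃ + e₄, 2 * e₄] : Fin 15 → ℕ) 4 : ℤ) - (![0, d₁, d₂, 2 * d₁, d₁ + d₂, 2 * d₂, e₃, d₁ + e₃, d₂ + e₃, 2 * e₃, e₄, d₁ + e₄, d₂ + e₄, e₃ + e₄, 2 * e₄] : Fin 15 → ℕ) j|) ^ 2) :
    (∏ j ∈ univ.erase (0 : Fin 15), |((![0, d₁, d₂, 2 * d₁, d₁ + d₂, 2 * d₂, d₃, d₁ + d₃, d₂ + d₃, 2 * d₃, d₄, d₁ + d₄, d₂ + d₄, d₃ + d₄, 2 * d₄] : Fin 15 → ℕ) 0 : ℤ) - (![0, d₁, d₂, 2 * d₁, d₁ + d₂, 2 * d₂, d₃, d₁ + d₃, d₂ + d₃, 2 * d₃, d₄, d₁ + d₄, d₂ + d₄, d₃ + d₄, 2 * d₄] : Fin 15 → ℕ) j|) * (∏ j ∈ univ.erase (2 : Fin 15), |((![0, d₁, d₂,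 2 * d₁, d₁ + d₂, 2 * d₂, d₃, d₁ + d₃, d₂ + d₃, 2 * d₃, d₄, d₁ + d₄, d₂ + d₄, d₃ + d₄, 2 * d₄] : Fin 15 → ℕ) 2 : ℤ) - (![0, d₁, d₂, 2 * d₁, d₁ + d₂, 2 * d₂, d₃, d₁ + d₃, d₂ + d₃, 2 * d₃, d₄, d₁ + d₄, d₂ + d₄, d₃ + d₄, 2 * d₄] : Fin 15 → ℕ) j|)
          * (∏ j ∈ univ.erase (3 : Fin 15), |((![0, d₁, d₂, 2 * d₁, d₁ + d₂, 2 * d₂, d₃, d₁ + d₃, d₂ + d₃, 2 * d₃, d₄, d₁ + d₄, d₂ + d₄, d₃ + d₄, 2 * d₄] : Fin 15 → ℕ) 3 : ℤ) - (![0, d₁, d₂, 2 * d₁, d₁ + d₂, 2 * d₂, d₃, d₁ + d₃, d₂ + d₃, 2 * d₃, d₄, d₁ + d₄, d₂ + d₄, d₃ + d₄, 2 * d₄] : Fin 15 → ℕ) j|) * (∏ j ∈ univ.erase (4 : Fin 15), |((![0, d₁, d₂, 2 * d₁, d₁ + d₂, 2 * d₂, d₃, d₁ + d₃, d₂ + d₃,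 2 * d₃, d₄, d₁ + d₄, d₂ + d₄, d₃ + d₄, 2 * d₄] : Fin 15 → ℕ) 4 : ℤ) - (![0, d₁, d₂, 2 * d₁, d₁ + d₂, 2 * d₂, d₃, d₁ + d₃, d₂ + d₃, 2 * d₃, d₄, d₁ + d₄, d₂ + d₄, d₃ + d₄, 2 * d₄] : Fin 15 → ℕ) j|)
        + (∏ j ∈ univ.erase (1 : Fin 15), |((![0, d₁, d₂, 2 * d₁, d₁ + d₂, 2 * d₂, d₃, d₁ + d₃, d₂ + d₃, 2 * d₃, d₄, d₁ + d₄, d₂ + d₄, d₃ + d₄, 2 * d₄] : Fin 15 → ℕ) 1 : ℤ) - (![0, d₁, d₂, 2 * d₁, d₁ + d₂, 2 * d₂, d₃, d₁ + d₃, d₂ + d₃, 2 * d₃, d₄, d₁ + d₄, d₂ + d₄, d₃ + d₄, 2 * d₄] : Fin 15 → ℕ) j|) * (∏ j ∈ univ.erase (2 : Fin 15), |((![0, d₁, d₂, 2 * d₁, d₁ + d₂, 2 * d₂, d₃, d₁ + d₃, d₂ + d₃, 2 * d₃, d₄, d₁ + d₄, d₂ + d₄, d₃ + d₄, 2 * d₄]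 : Fin 15 → ℕ) 2 : ℤ) - (![0, d₁, d₂, 2 * d₁, d₁ + d₂, 2 * d₂, d₃, d₁ + d₃, d₂ + d₃, 2 * d₃, d₄, d₁ + d₄, d₂ + d₄, d₃ + d₄, 2 * d₄] : Fin 15 → ℕ) j|) ^ 2
          * (∏ j ∈ univ.erase (3 : Fin 15), |((![0, d₁, d₂, 2 * d₁, d₁ + d₂, 2 * d₂, d₃, d₁ + d₃, d₂ + d₃, 2 * d₃, d₄, d₁ + d₄, d₂ + d₄, d₃ + d₄, 2 * d₄] : Fin 15 → ℕ) 3 : ℤ) - (![0, d₁, d₂, 2 * d₁, d₁ + d₂, 2 * d₂, d₃, d₁ + d₃, d₂ + d₃, 2 * d₃, d₄, d₁ + d₄, d₂ + d₄, d₃ + d₄, 2 * d₄] : Fin 15 → ℕ) j|)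
      ≤ (∏ j ∈ univ.erase (0 : Fin 15), |((![0, d₁, d₂, 2 * d₁, d₁ + d₂, 2 * d₂, d₃, d₁ + d₃, d₂ + d₃, 2 * d₃, d₄, d₁ + d₄, d₂ + d₄, d₃ + d₄, 2 * d₄] : Fin 15 → ℕ) 0 : ℤ) - (![0, d₁, d₂, 2 * d₁, d₁ + d₂, 2 * d₂, d₃, d₁ + d₃, d₂ + d₃, 2 * d₃, d₄, d₁ + d₄, d₂ + d₄, d₃ + d₄, 2 * d₄] : Fin 15 → ℕ) j|) * (∏ j ∈ univ.erase (1 : Fin 15), |((![0, d₁, d₂, 2 * d₁, d₁ + d₂, 2 * d₂, d₃, d₁ + d₃, d₂ + d₃, 2 * d₃, d₄, d₁ + d₄, d₂ + d₄, d₃ + d₄, 2 * d₄] : Fin 15 → ℕ) 1 : ℤ) - (![0, d₁, d₂, 2 * d₁, d₁ + d₂, 2 * d₂, d₃, d₁ + d₃, d₂ + d₃, 2 * d₃, d₄, d₁ + d₄, d₂ + d₄, d₃ + d₄, 2 * d₄] : Fin 15 → ℕ) j|)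
          * (∏ j ∈ univ.erase (4 : Fin 15), |((![0, d₁, d₂, 2 * d₁, d₁ + d₂, 2 * d₂, d₃, d₁ + d₃, d₂ + d₃, 2 * d₃, d₄, d₁ + d₄, d₂ + d₄, d₃ + d₄, 2 * d₄] : Fin 15 → ℕ) 4 : ℤ) - (![0, d₁, d₂, 2 * d₁, d₁ + d₂, 2 * d₂, d₃, d₁ + d₃, d₂ + d₃, 2 * d₃, d₄, d₁ + d₄, d₂ + d₄, d₃ + d₄, 2 * d₄] : Fin 15 → ℕ) j|) ^ 2 := by
  have hd23 : 2 * d₂ < d₃ := by omega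
  rw [farTop_weight_0 d₁ d₂ e₃ e₄ h12 h21 he23 he34, farTop_weight_1 d₁ d₂ e₃ e₄ h1 h12 h21 he23 he34,
    farTop_weight_2 d₁ d₂ e₃ e₄ h12 h21 he23 he34, farTop_weight_3 d₁ d₂ e₃ e₄ h1 h12 h21 he23 he34,
    farTop_weight_4 d₁ d₂ e₃ e₄ h12 h21 he23 he34] at hM0
  rw [farTop_weight_0 d₁ d₂ d₃ d₄ h12 h21 hd23 hd34, farTop_weight_1 d₁ d₂ d₃ d₄ h1 h12 h21 hd23 hd34,
    farTop_weight_2 d₁ d₂ d₃ d₄ h12 h21 hd23 hd34, farTop_weight_3 d₁ d₂ d₃ d₄ h1 h12 h21 hd23 hd34,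
    farTop_weight_4 d₁ d₂ d₃ d₄ h12 h21 hd23 hd34]
  have z1 : (0 : ℤ) < d₁ := by exact_mod_cast h1
  have z12 : (d₁ : ℤ) < d₂ := by exact_mod_cast h12
  have z21 : (d₂ : ℤ) < 2 * d₁ := by exact_mod_cast h21
  have p1 : (0 : ℤ) < d₂ - d₁ := by linarith
  have p2 : (0 : ℤ) < 2 * d₁ - d₂ := by linarith
  have p3 : (0 : ℤ) < 2 * d₂ - d₁ := by linarith
  have p4 : (0 : ℤ) < 2 * d₂ - 2 * d₁ := by linarith
  have p5 : (0 : ℤ) < d₂ := by linarith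
  have hLb : (0 : ℤ) ≤ (((d₁ : ℤ) * d₂ * (2 * d₁) * (d₁ + d₂) * (2 * d₂)) * ((d₂ : ℤ) * (d₂ - d₁) * (2 * d₁ - d₂) * d₁ * d₂) * (2 * (d₁ : ℤ) * d₁ * (2 * d₁ - d₂) * (d₂ - d₁) * (2 * d₂ - 2 * d₁)) * (((d₁ : ℤ) + d₂) * d₂ * d₁ * (d₂ - d₁) * (d₂ - d₁))) := by positivity
  have hLc : (0 : ℤ) ≤ (((d₁ : ℤ) * (d₂ - d₁) * d₁ * d₂ * (2 * d₂ - d₁)) * ((d₂ : ℤ) * (d₂ - d₁) * (2 * d₁ - d₂) * d₁ * d₂) ^ 2 * (2 * (d₁ : ℤ) * d₁ * (2 * d₁ - d₂) * (d₂ - d₁) * (2 * d₂ - 2 * d₁))) := by positivity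
  have hM0' : (((d₁ : ℤ) * d₂ * (2 * d₁) * (d₁ + d₂) * (2 * d₂)) * ((d₂ : ℤ) * (d₂ - d₁) * (2 * d₁ - d₂) * d₁ * d₂) * (2 * (d₁ : ℤ) * d₁ * (2 * d₁ - d₂) * (d₂ - d₁) * (2 * d₂ - 2 * d₁)) * (((d₁ : ℤ) + d₂) * d₂ * d₁ * (d₂ - d₁) * (d₂ - d₁))) * ((∏ i : Fin 9, (((![e₃, d₁ + e₃, d₂ + e₃, 2 * e₃, e₄, d₁ + e₄, d₂ + e₄, e₃ + e₄, 2 * e₄] : Fin 9 → ℕ) i : ℤ) - 0)) * (∏ i : Fin 9, (((![e₃, d₁ + e₃, d₂ + e₃, 2 * e₃, e₄, d₁ + e₄, d₂ + e₄, e₃ + e₄, 2 * e₄] : Fin 9 → ℕ) i : ℤ) - (d₂ : ℤ))) * (∏ i : Fin 9, (((![e₃, d₁ + e₃, d₂ + e₃, 2 * e₃, e₄, d₁ + e₄, d₂ + e₄, e₃ + e₄, 2 * e₄] : Fin 9 → ℕ) i : ℤ) - (2 * d₁ : ℤ))) * (∏ i : Fin 9, (((![e₃, d₁ + e₃, d₂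 + e₃, 2 * e₃, e₄, d₁ + e₄, d₂ + e₄, e₃ + e₄, 2 * e₄] : Fin 9 → ℕ) i : ℤ) - ((d₁ : ℤ) + d₂))))
        + (((d₁ : ℤ) * (d₂ - d₁) * d₁ * d₂ * (2 * d₂ - d₁)) * ((d₂ : ℤ) * (d₂ - d₁) * (2 * d₁ - d₂) * d₁ * d₂) ^ 2 * (2 * (d₁ : ℤ) * d₁ * (2 * d₁ - d₂) * (d₂ - d₁) * (2 * d₂ - 2 * d₁))) * ((∏ i : Fin 9, (((![e₃, d₁ + e₃, d₂ + e₃, 2 * e₃, e₄, d₁ + e₄, d₂ + e₄, e₃ + e₄, 2 * e₄] : Fin 9 → ℕ) i : ℤ) - (d₁ : ℤ))) * (∏ i : Fin 9, (((![e₃, d₁ + e₃, d₂ + e₃, 2 * e₃, e₄, d₁ + e₄, d₂ + e₄, e₃ + e₄, 2 * e₄] : Fin 9 → ℕ) i : ℤ) - (d₂ : ℤ))) ^ 2 * (∏ i : Fin 9, (((![e₃, d₁ + e₃, d₂ + e₃, 2 * e₃, e₄, d₁ + e₄, d₂ + e₄, e₃ + e₄, 2 * e₄] : Fin 9 → ℕ)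 i : ℤ) - (2 * d₁ : ℤ))))
      ≤ (((d₁ : ℤ) * d₂ * (2 * d₁) * (d₁ + d₂) * (2 * d₂)) * ((d₁ : ℤ) * (d₂ - d₁) * d₁ * d₂ * (2 * d₂ - d₁)) * (((d₁ : ℤ) + d₂) * d₂ * d₁ * (d₂ - d₁) * (d₂ - d₁)) ^ 2) * ((∏ i : Fin 9, (((![e₃, d₁ + e₃, d₂ + e₃, 2 * e₃, e₄, d₁ + e₄, d₂ + e₄, e₃ + e₄, 2 * e₄] : Fin 9 → ℕ) i : ℤ) - 0)) * (∏ i : Fin 9, (((![e₃, d₁ + e₃, d₂ + e₃, 2 * e₃, e₄, d₁ + e₄, d₂ + e₄, e₃ + e₄, 2 * e₄] : Fin 9 → ℕ) i : ℤ) - (d₁ : ℤ))) * (∏ i : Fin 9, (((![e₃, d₁ + e₃, d₂ + e₃, 2 * e₃, e₄, d₁ + e₄, d₂ + e₄, e₃ + e₄, 2 * e₄] : Fin 9 → ℕ) i : ℤ) - ((d₁ : ℤ) + d₂))) ^ 2) :=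
    calc _ = _ := by ring
      _ ≤ _ := hM0
      _ = _ := by ring
  have key := farTop_core_mono d₁ d₂ h1 h12 (![d₃, d₁ + d₃, d₂ + d₃, 2 * d₃, d₄, d₁ + d₄, d₂ + d₄, d₃ + d₄, 2 * d₄] : Fin 9 → ℕ) (![e₃, d₁ + e₃, d₂ + e₃, 2 * e₃, e₄, d₁ + e₄, d₂ + e₄, e₃ + e₄, 2 * e₄] : Fin 9 → ℕ)
    (by intro i; fin_cases i <;> simp <;> omega) (by intro i; fin_cases i <;> simp <;> omega)
    (((d₁ : ℤ) * d₂ * (2 * d₁) * (d₁ + d₂) * (2 * d₂)) * ((d₁ : ℤ) * (d₂ - d₁) * d₁ * d₂ * (2 * d₂ - d₁)) * (((d₁ : ℤ) + d₂) * d₂ * d₁ * (d₂ - d₁) * (d₂ - d₁)) ^ 2) (((d₁ : ℤ) * d₂ * (2 * d₁) * (d₁ + d₂) * (2 * d₂)) * ((d₂ : ℤ) * (d₂ - d₁) * (2 * d₁ - d₂) * d₁ * d₂) * (2 * (d₁ : ℤ) * d₁ * (2 * d₁ - d₂) * (d₂ - d₁) * (2 * d₂ - 2 * d₁)) * (((d₁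 : ℤ) + d₂) * d₂ * d₁ * (d₂ - d₁) * (d₂ - d₁))) (((d₁ : ℤ) * (d₂ - d₁) * d₁ * d₂ * (2 * d₂ - d₁)) * ((d₂ : ℤ) * (d₂ - d₁) * (2 * d₁ - d₂) * d₁ * d₂) ^ 2 * (2 * (d₁ : ℤ) * d₁ * (2 * d₁ - d₂) * (d₂ - d₁) * (2 * d₂ - 2 * d₁))) hLb hLc hM0'
  calc _ = _ := by ring
    _ ≤ _ := key
    _ = _ := by ring

/-- **Door B on the WHOLE far-top class-G family `(0,2,3,d₃,d₄)` (kernel, two parameters):** for all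
`d₃ ≥ 7 = 2·3+1` and all `d₄ > 2d₃`, every real symmetric `2 × 2` pencil on `(0,2,3,d₃,d₄)` with at least `14`
distinct positive determinant roots has word `D I I I D` — no II-ended fourteen on any support of the family.
(`Census.farTop_newton_mono` from the corner `(2,3,7,15)`, decided numerically, and `Census.doorB_word_farTop`.)
[folklore] -/
theorem doorB_word_on_2_5_0_2_3_farTop (d₃ d₄ : ℕ) (h3 : 7 ≤ d₃) (h4 : 2 * d₃ < d₄)
    (S : Fin 5 → Matrix (Fin 2) (Fin 2) ℝ) (hS : ∀ l, (S l).IsSymm)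
    (h14 : 14 ≤ ((∑ l, ((X : ℝ[X]) ^ (![0, 2, 3, d₃, d₄] : Fin 5 → ℕ) l) • (S l).map C).det.roots.toFinset.filter
      (fun t => 0 < t)).card) :
    0 < (S 0).det ∧ (S 1).det < 0 ∧ (S 2).det < 0 ∧ (S 3).det < 0 ∧ 0 < (S 4).det :=
  doorB_word_farTop 2 3 d₃ d₄ (by norm_num) (by norm_num) (by norm_num) (by omega) h4
    (farTop_newton_mono 2 3 d₃ d₄ 7 15 (by norm_num) (by norm_num) (by norm_num) (by norm_num) (by norm_num)
      h3 (by omega) h4 (by decide)) S hS h14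

/-- **Door B on the WHOLE far-top class-G family `(0,3,4,d₃,d₄)` (kernel, two parameters):** for all
`d₃ ≥ 9 = 2·4+1` and all `d₄ > 2d₃`, every real symmetric `2 × 2` pencil on `(0,3,4,d₃,d₄)` with at least `14`
distinct positive determinant roots has word `D I I I D` — no II-ended fourteen on any support of the family.
(`Census.farTop_newton_mono` from the corner `(3,4,9,19)`, decided numerically, and `Census.doorB_word_farTop`.)
[folklore] -/
theorem doorB_word_on_2_5_0_3_4_farTop (d₃ d₄ : ℕ) (h3 : 9 ≤ d₃) (h4 : 2 * d₃ < d₄)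
    (S : Fin 5 → Matrix (Fin 2) (Fin 2) ℝ) (hS : ∀ l, (S l).IsSymm)
    (h14 : 14 ≤ ((∑ l, ((X : ℝ[X]) ^ (![0, 3, 4, d₃, d₄] : Fin 5 → ℕ) l) • (S l).map C).det.roots.toFinset.filter
      (fun t => 0 < t)).card) :
    0 < (S 0).det ∧ (S 1).det < 0 ∧ (S 2).det < 0 ∧ (S 3).det < 0 ∧ 0 < (S 4).det :=
  doorB_word_farTop 3 4 d₃ d₄ (by norm_num) (by norm_num) (by norm_num) (by omega) h4
    (farTop_newton_mono 3 4 d₃ d₄ 9 19 (by norm_num) (by norm_num) (by norm_num) (by norm_num) (by norm_num)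
      h3 (by omega) h4 (by decide)) S hS h14

/-- **Door B on the WHOLE far-top class-G family `(0,3,5,d₃,d₄)` (kernel, two parameters):** for all
`d₃ ≥ 11 = 2·5+1` and all `d₄ > 2d₃`, every real symmetric `2 × 2` pencil on `(0,3,5,d₃,d₄)` with at least `14`
distinct positive determinant roots has word `D I I I D` — no II-ended fourteen on any support of the family.
(`Census.farTop_newton_mono` from the corner `(3,5,11,23)`, decided numerically, and `Census.doorB_word_farTop`.)
[folklore] -/
theorem doorB_word_on_2_5_0_3_5_farTop (d₃ d₄ : ℕ) (h3 : 11 ≤ d₃) (h4 : 2 * d₃ < d₄)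
    (S : Fin 5 → Matrix (Fin 2) (Fin 2) ℝ) (hS : ∀ l, (S l).IsSymm)
    (h14 : 14 ≤ ((∑ l, ((X : ℝ[X]) ^ (![0, 3, 5, d₃, d₄] : Fin 5 → ℕ) l) • (S l).map C).det.roots.toFinset.filter
      (fun t => 0 < t)).card) :
    0 < (S 0).det ∧ (S 1).det < 0 ∧ (S 2).det < 0 ∧ (S 3).det < 0 ∧ 0 < (S 4).det :=
  doorB_word_farTop 3 5 d₃ d₄ (by norm_num) (by norm_num) (by norm_num) (by omega) h4
    (farTop_newton_mono 3 5 d₃ d₄ 11 23 (by norm_num) (by norm_num) (by norm_num) (by norm_num) (by norm_num)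
      h3 (by omega) h4 (by decide)) S hS h14

/-- **Door B on the WHOLE far-top class-G family `(0,4,6,d₃,d₄)` (kernel, two parameters):** for all
`d₃ ≥ 13 = 2·6+1` and all `d₄ > 2d₃`, every real symmetric `2 × 2` pencil on `(0,4,6,d₃,d₄)` with at least `14`
distinct positive determinant roots has word `D I I I D` — no II-ended fourteen on any support of the family.
(`Census.farTop_newton_mono` from the corner `(4,6,13,27)`, decided numerically, and `Census.doorB_word_farTop`.)
[folklore] -/
theorem doorB_word_on_2_5_0_4_6_farTop (d₃ d₄ : ℕ) (h3 : 13 ≤ d₃) (h4 : 2 * d₃ < d₄)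
    (S : Fin 5 → Matrix (Fin 2) (Fin 2) ℝ) (hS : ∀ l, (S l).IsSymm)
    (h14 : 14 ≤ ((∑ l, ((X : ℝ[X]) ^ (![0, 4, 6, d₃, d₄] : Fin 5 → ℕ) l) • (S l).map C).det.roots.toFinset.filter
      (fun t => 0 < t)).card) :
    0 < (S 0).det ∧ (S 1).det < 0 ∧ (S 2).det < 0 ∧ (S 3).det < 0 ∧ 0 < (S 4).det :=
  doorB_word_farTop 4 6 d₃ d₄ (by norm_num) (by norm_num) (by norm_num) (by omega) h4
    (farTop_newton_mono 4 6 d₃ d₄ 13 27 (by norm_num) (by norm_num) (by norm_num) (by norm_num) (by norm_num)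
      h3 (by omega) h4 (by decide)) S hS h14

/-- **Door B on the WHOLE far-top class-G family `(0,4,7,d₃,d₄)` (kernel, two parameters):** for all
`d₃ ≥ 15 = 2·7+1` and all `d₄ > 2d₃`, every real symmetric `2 × 2` pencil on `(0,4,7,d₃,d₄)` with at least `14`
distinct positive determinant roots has word `D I I I D` — no II-ended fourteen on any support of the family.
(`Census.farTop_newton_mono` from the corner `(4,7,15,31)`, decided numerically, and `Census.doorB_word_farTop`.)
[folklore] -/
theorem doorB_word_on_2_5_0_4_7_farTop (d₃ d₄ : ℕ) (h3 : 15 ≤ d₃) (h4 : 2 * d₃ < d₄)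
    (S : Fin 5 → Matrix (Fin 2) (Fin 2) ℝ) (hS : ∀ l, (S l).IsSymm)
    (h14 : 14 ≤ ((∑ l, ((X : ℝ[X]) ^ (![0, 4, 7, d₃, d₄] : Fin 5 → ℕ) l) • (S l).map C).det.roots.toFinset.filter
      (fun t => 0 < t)).card) :
    0 < (S 0).det ∧ (S 1).det < 0 ∧ (S 2).det < 0 ∧ (S 3).det < 0 ∧ 0 < (S 4).det :=
  doorB_word_farTop 4 7 d₃ d₄ (by norm_num) (by norm_num) (by norm_num) (by omega) h4
    (farTop_newton_mono 4 7 d₃ d₄ 15 31 (by norm_num) (by norm_num) (by norm_num) (by norm_num) (by norm_num)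
      h3 (by omega) h4 (by decide)) S hS h14


/-- Census column `(0,2,3,9,N)`, all `N ≥ 19`: every real symmetric `2 × 2` pencil with `≥ 14` distinct positive
determinant roots has word `D I I I D` (instance of `doorB_word_on_2_5_0_2_3_farTop`). [folklore] -/
theorem doorB_word_on_2_5_0_2_3_9_N (N : ℕ) (hN : 19 ≤ N) (S : Fin 5 → Matrix (Fin 2) (Fin 2) ℝ)
    (hS : ∀ l, (S l).IsSymm)
    (h14 : 14 ≤ ((∑ l, ((X : ℝ[X]) ^ (![0, 2, 3, 9, N] : Fin 5 → ℕ) l) • (S l).map C).det.roots.toFinset.filter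
      (fun t => 0 < t)).card) :
    0 < (S 0).det ∧ (S 1).det < 0 ∧ (S 2).det < 0 ∧ (S 3).det < 0 ∧ 0 < (S 4).det :=
  doorB_word_on_2_5_0_2_3_farTop 9 N (by norm_num) (by omega) S hS h14

/-- Census column `(0,3,4,10,N)`, all `N ≥ 21`: every real symmetric `2 × 2` pencil with `≥ 14` distinct positive
determinant roots has word `D I I I D` (instance of `doorB_word_on_2_5_0_3_4_farTop`). [folklore] -/
theorem doorB_word_on_2_5_0_3_4_10_N (N : ℕ) (hN : 21 ≤ N) (S : Fin 5 → Matrix (Fin 2) (Fin 2) ℝ)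
    (hS : ∀ l, (S l).IsSymm)
    (h14 : 14 ≤ ((∑ l, ((X : ℝ[X]) ^ (![0, 3, 4, 10, N] : Fin 5 → ℕ) l) • (S l).map C).det.roots.toFinset.filter
      (fun t => 0 < t)).card) :
    0 < (S 0).det ∧ (S 1).det < 0 ∧ (S 2).det < 0 ∧ (S 3).det < 0 ∧ 0 < (S 4).det :=
  doorB_word_on_2_5_0_3_4_farTop 10 N (by norm_num) (by omega) S hS h14

/-- Census column `(0,3,4,9,N)`, all `N ≥ 19`: every real symmetric `2 × 2` pencil with `≥ 14` distinct positive
determinant roots has word `D I I I D` (instance of `doorB_word_on_2_5_0_3_4_farTop`). [folklore] -/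
theorem doorB_word_on_2_5_0_3_4_9_N (N : ℕ) (hN : 19 ≤ N) (S : Fin 5 → Matrix (Fin 2) (Fin 2) ℝ)
    (hS : ∀ l, (S l).IsSymm)
    (h14 : 14 ≤ ((∑ l, ((X : ℝ[X]) ^ (![0, 3, 4, 9, N] : Fin 5 → ℕ) l) • (S l).map C).det.roots.toFinset.filter
      (fun t => 0 < t)).card) :
    0 < (S 0).det ∧ (S 1).det < 0 ∧ (S 2).det < 0 ∧ (S 3).det < 0 ∧ 0 < (S 4).det :=
  doorB_word_on_2_5_0_3_4_farTop 9 N (by norm_num) (by omega) S hS h14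

/-- Census column `(0,2,3,8,N)`, all `N ≥ 17`: every real symmetric `2 × 2` pencil with `≥ 14` distinct positive
determinant roots has word `D I I I D` (instance of `doorB_word_on_2_5_0_2_3_farTop`). [folklore] -/
theorem doorB_word_on_2_5_0_2_3_8_N (N : ℕ) (hN : 17 ≤ N) (S : Fin 5 → Matrix (Fin 2) (Fin 2) ℝ)
    (hS : ∀ l, (S l).IsSymm)
    (h14 : 14 ≤ ((∑ l, ((X : ℝ[X]) ^ (![0, 2, 3, 8, N] : Fin 5 → ℕ) l) • (S l).map C).det.roots.toFinset.filter
      (fun t => 0 < t)).card) :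
    0 < (S 0).det ∧ (S 1).det < 0 ∧ (S 2).det < 0 ∧ (S 3).det < 0 ∧ 0 < (S 4).det :=
  doorB_word_on_2_5_0_2_3_farTop 8 N (by norm_num) (by omega) S hS h14

/-- Census column `(0,2,3,7,N)`, all `N ≥ 15`: every real symmetric `2 × 2` pencil with `≥ 14` distinct positive
determinant roots has word `D I I I D` (instance of `doorB_word_on_2_5_0_2_3_farTop`). [folklore] -/
theorem doorB_word_on_2_5_0_2_3_7_N (N : ℕ) (hN : 15 ≤ N) (S : Fin 5 → Matrix (Fin 2) (Fin 2) ℝ)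
    (hS : ∀ l, (S l).IsSymm)
    (h14 : 14 ≤ ((∑ l, ((X : ℝ[X]) ^ (![0, 2, 3, 7, N] : Fin 5 → ℕ) l) • (S l).map C).det.roots.toFinset.filter
      (fun t => 0 < t)).card) :
    0 < (S 0).det ∧ (S 1).det < 0 ∧ (S 2).det < 0 ∧ (S 3).det < 0 ∧ 0 < (S 4).det :=
  doorB_word_on_2_5_0_2_3_farTop 7 N (by norm_num) (by omega) S hS h14

/-- Census column `(0,3,5,11,N)`, all `N ≥ 23`: every real symmetric `2 × 2` pencil with `≥ 14` distinct positive
determinant roots has word `D I I I D` (instance of `doorB_word_on_2_5_0_3_5_farTop`). [folklore] -/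
theorem doorB_word_on_2_5_0_3_5_11_N (N : ℕ) (hN : 23 ≤ N) (S : Fin 5 → Matrix (Fin 2) (Fin 2) ℝ)
    (hS : ∀ l, (S l).IsSymm)
    (h14 : 14 ≤ ((∑ l, ((X : ℝ[X]) ^ (![0, 3, 5, 11, N] : Fin 5 → ℕ) l) • (S l).map C).det.roots.toFinset.filter
      (fun t => 0 < t)).card) :
    0 < (S 0).det ∧ (S 1).det < 0 ∧ (S 2).det < 0 ∧ (S 3).det < 0 ∧ 0 < (S 4).det :=
  doorB_word_on_2_5_0_3_5_farTop 11 N (by norm_num) (by omega) S hS h14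

/-- Census column `(0,3,5,12,N)`, all `N ≥ 25`: every real symmetric `2 × 2` pencil with `≥ 14` distinct positive
determinant roots has word `D I I I D` (instance of `doorB_word_on_2_5_0_3_5_farTop`). [folklore] -/
theorem doorB_word_on_2_5_0_3_5_12_N (N : ℕ) (hN : 25 ≤ N) (S : Fin 5 → Matrix (Fin 2) (Fin 2) ℝ)
    (hS : ∀ l, (S l).IsSymm)
    (h14 : 14 ≤ ((∑ l, ((X : ℝ[X]) ^ (![0, 3, 5, 12, N] : Fin 5 → ℕ) l) • (S l).map C).det.roots.toFinset.filter
      (fun t => 0 < t)).card) :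
    0 < (S 0).det ∧ (S 1).det < 0 ∧ (S 2).det < 0 ∧ (S 3).det < 0 ∧ 0 < (S 4).det :=
  doorB_word_on_2_5_0_3_5_farTop 12 N (by norm_num) (by omega) S hS h14

/-- Census column `(0,2,3,10,N)`, all `N ≥ 21`: every real symmetric `2 × 2` pencil with `≥ 14` distinct positive
determinant roots has word `D I I I D` (instance of `doorB_word_on_2_5_0_2_3_farTop`). [folklore] -/
theorem doorB_word_on_2_5_0_2_3_10_N (N : ℕ) (hN : 21 ≤ N) (S : Fin 5 → Matrix (Fin 2) (Fin 2) ℝ)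
    (hS : ∀ l, (S l).IsSymm)
    (h14 : 14 ≤ ((∑ l, ((X : ℝ[X]) ^ (![0, 2, 3, 10, N] : Fin 5 → ℕ) l) • (S l).map C).det.roots.toFinset.filter
      (fun t => 0 < t)).card) :
    0 < (S 0).det ∧ (S 1).det < 0 ∧ (S 2).det < 0 ∧ (S 3).det < 0 ∧ 0 < (S 4).det :=
  doorB_word_on_2_5_0_2_3_farTop 10 N (by norm_num) (by omega) S hS h14

/-- Census column `(0,2,3,11,N)`, all `N ≥ 23`: every real symmetric `2 × 2` pencil with `≥ 14` distinct positive
determinant roots has word `D I I I D` (instance of `doorB_word_on_2_5_0_2_3_farTop`). [folklore] -/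
theorem doorB_word_on_2_5_0_2_3_11_N (N : ℕ) (hN : 23 ≤ N) (S : Fin 5 → Matrix (Fin 2) (Fin 2) ℝ)
    (hS : ∀ l, (S l).IsSymm)
    (h14 : 14 ≤ ((∑ l, ((X : ℝ[X]) ^ (![0, 2, 3, 11, N] : Fin 5 → ℕ) l) • (S l).map C).det.roots.toFinset.filter
      (fun t => 0 < t)).card) :
    0 < (S 0).det ∧ (S 1).det < 0 ∧ (S 2).det < 0 ∧ (S 3).det < 0 ∧ 0 < (S 4).det :=
  doorB_word_on_2_5_0_2_3_farTop 11 N (by norm_num) (by omega) S hS h14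

end Summit.ValiantsHypothesis.ValiantsHypothesis.Theorems.LacunarySymmetroidMatrixDescartes.Census
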